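import Summits.Ventures.WeilGRH.TwistedFarComplex
import Summits.RiemannHypothesis.RiemannHypothesis.Theorems.WeilFormatCCertificate
import HarnessLib

/-!
# GRH arm (rh-explicit, venture WeilGRH): format C for a COMPLEX character — ONE realified certificate (block + columns +
  kernel PSD check) ⟹ `WeilPositivityOnChar χ a`, with the far coercivity DISCHARGED

Cell `rh-explicit`, WEIL TRACK — GRH ARM (lit/typing seat weil-grh-5 gen11).  For a complex character the hermitian Gram kernel
`G = twistedGramCoeffC χ a` does not split into even/odd sectors, so weil-10's ℕ-indexed ∀N soundness
(`WeilFormatC.sum_range_mul_mul_nonneg_of_certificate_sum`) is applied to the REALIFIED kernel on the interleaved enumeration of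
`modes N × {re, im}`:  mode `ι(i)` = `0, 1, −1, 2, −2, …` (`i = 0, 1, 2, 3, 4, …`), index `j = 2i + s` (`s = 0` real part, `s = 1`
imaginary part), i.e. `enc p s = 2κ(p) + s`, `κ(p) = 2|p| − 1` (`p > 0`), `2|p|` (`p ≤ 0`); then `range (4N+2) ↔ modes N × {0,1}`
(`sum_range_realify`) and "far" `j ≥ 4B − 2 ↔ |p| ≥ B`.  The realified entries are
`M(enc p 0, enc p' 0) = M(enc p 1, enc p' 1) = Re G(p,p')`, `M(enc p 0, enc p' 1) = −Im G(p,p')`, `M(enc p 1, enc p' 0) = Im G(p,p')`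
(hypothesis `hM` on an arbitrary table-backed `M : ℕ → ℕ → ℝ`), so that `Σ v_j v_{j'} M(j,j') = Re Σ conj(c_p) c_{p'} G(p,p')`
with `c_p = v(enc p 0) + i·v(enc p 1)` (`sum_sum_range_realify_form`).

* `weilPositivityOnChar_of_twistedC_formatC_certificates` — `q ≠ 1`, ANY χ mod q, `a > 0`, block `B ≥ 2` (ℕ-block
  `4B − 2` = all `(p, s)` with `|p| < B`), far weights `W(n) = 2e⁻_B(n) − A_op⁺(a) + log q` POSITIVE on `n ≥ B` (`hW`), a
  coupling majorant `U` (`hU`, L-C3b — data/analysis supplied by the rung) and the kernel certificate `hS`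
  ⟹ `WeilPositivityOnChar χ a`.  The far hypothesis `hfar` of the soundness theorem is PROVED here from
  `re_twistedGramCoeffC_modes_far_ge` (`TwistedFarComplex.lean`).

No definitions; no named facts; RH/GRH-free; standard axioms.
-/

set_option autoImplicit false

noncomputable section

open Complex Finset Matrix
open scoped Real BigOperators ComplexConjugate ArithmeticFunction.vonMangoldt

namespace Summit.Ventures.WeilGRH

open Literature.NumberTheory.LFunctions
open Literature.NumberTheory.LFunctions.Yoshida1992 (modes freq mem_modes)
open Literature.Analysis.SpecialFunctions
open Summit.RiemannHypothesis.RiemannHypothesis.Theorems.WeilFormatC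

variable {q : ℕ} {a : ℝ}

/-! ## The interleaved enumeration of `modes N × {re, im}` -/

section Enum

/-- `enc p s < 4B − 2` when `|p| < B` (`s ≤ 1`): near modes sit in the ℕ-block. -/
theorem enc_lt_of_natAbs_lt {p : ℤ} {s B : ℕ} (hs : s ≤ 1) (hp : p.natAbs < B) :
    2 * (if 0 < p then 2 * p.natAbs - 1 else 2 * p.natAbs) + s < 4 * B - 2 := by
  split_ifs <;> omega

/-- `4N + 2 ≤ enc p s` when `N < |p|`: modes beyond `N` sit beyond `range (4N+2)`. -/
theorem le_enc_of_lt_natAbs {p : ℤ} {s N : ℕ} (hp : N < p.natAbs) :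
    4 * N + 2 ≤ 2 * (if 0 < p then 2 * p.natAbs - 1 else 2 * p.natAbs) + s := by
  split_ifs <;> omega

/-- `B ≤ |p|` forces `4B − 2 ≤ enc p s`. -/
theorem le_enc_of_le_natAbs {p : ℤ} {s B : ℕ} (hp : B ≤ p.natAbs) :
    4 * B - 2 ≤ 2 * (if 0 < p then 2 * p.natAbs - 1 else 2 * p.natAbs) + s := by
  split_ifs <;> omega

/-- The mode size is recovered from the index: `(enc p s / 2 + 1) / 2 = |p|` (`s ≤ 1`). -/
theorem modeAbs_enc (p : ℤ) {s : ℕ} (hs : s ≤ 1) :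
    (((2 * (if 0 < p then 2 * p.natAbs - 1 else 2 * p.natAbs) + s) / 2 + 1) / 2) = p.natAbs := by
  split_ifs with h
  · have : 1 ≤ p.natAbs := by omega
    omega
  · omega

/-- **`range (4N+2) ↔ modes N × {0,1}`**: `Σ_{j<4N+2} F(j) = Σ_{p∈modes N} (F(enc p 0) + F(enc p 1))`. -/
theorem sum_range_realify (F : ℕ → ℝ) (N : ℕ) :
    ∑ j ∈ Finset.range (4 * N + 2), F j
      = ∑ p ∈ modes N, (F (2 * (if 0 < p then 2 * p.natAbs - 1 else 2 * p.natAbs))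
          + F (2 * (if 0 < p then 2 * p.natAbs - 1 else 2 * p.natAbs) + 1)) := by
  induction N with
  | zero =>
    have h0 : modes 0 = {0} := by ext k; simp [mem_modes]
    rw [h0, Finset.sum_singleton]
    simp [Finset.sum_range_succ]
  | succ N ih =>
    rw [show 4 * (N + 1) + 2 = 4 * N + 2 + 1 + 1 + 1 + 1 by ring, Finset.sum_range_succ, Finset.sum_range_succ,
      Finset.sum_range_succ, Finset.sum_range_succ, ih, modes_succ, Finset.sum_insert, Finset.sum_insert]
    · have e1 : (2 * (if (0 : ℤ) < (N : ℤ) + 1 then 2 * ((N : ℤ) + 1).natAbs - 1 else 2 * ((N : ℤ) + 1).natAbs))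
          = 4 * N + 2 := by
        rw [if_pos (by positivity)]; omega
      have e2 : (2 * (if (0 : ℤ) < -((N : ℤ) + 1) then 2 * (-((N : ℤ) + 1)).natAbs - 1 else 2 * (-((N : ℤ) + 1)).natAbs))
          = 4 * N + 2 + 1 + 1 := by
        rw [if_neg (by omega)]; omega
      rw [e1, e2]
      ring
    · simp only [mem_modes, abs_le]; omega
    · simp only [Finset.mem_insert, mem_modes, abs_le]
      omega

/-- Double-sum form of `sum_range_realify`. -/
theorem sum_sum_range_realify (Φ : ℕ → ℕ → ℝ) (N : ℕ) :
    ∑ j ∈ Finset.range (4 * N + 2), ∑ j' ∈ Finset.range (4 * N + 2), Φ j j'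
      = ∑ p ∈ modes N, ∑ p' ∈ modes N,
          (Φ (2 * (if 0 < p then 2 * p.natAbs - 1 else 2 * p.natAbs)) (2 * (if 0 < p' then 2 * p'.natAbs - 1 else 2 * p'.natAbs))
            + Φ (2 * (if 0 < p then 2 * p.natAbs - 1 else 2 * p.natAbs)) (2 * (if 0 < p' then 2 * p'.natAbs - 1 else 2 * p'.natAbs) + 1)
            + Φ (2 * (if 0 < p then 2 * p.natAbs - 1 else 2 * p.natAbs) + 1) (2 * (if 0 < p' then 2 * p'.natAbs - 1 else 2 * p'.natAbs))
            + Φ (2 * (if 0 < p then 2 * p.natAbs - 1 else 2 * p.natAbs) + 1) (2 * (if 0 < p' then 2 * p'.natAbs - 1 else 2 * p'.natAbs) + 1)) := by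
  rw [sum_range_realify]
  refine Finset.sum_congr rfl fun p _ ↦ ?_
  rw [sum_range_realify, sum_range_realify, ← Finset.sum_add_distrib]
  exact Finset.sum_congr rfl fun p' _ ↦ by ring

end Enum

/-! ## The realified kernel against the hermitian one -/

section Realify

variable (χ : DirichletCharacter ℂ q) (a)

/-- **Realified form = hermitian form.**  If `M` carries the realified entries of `G = twistedGramCoeffC χ a` on the
interleaved enumeration (`hM`), then for every real `v` on `range (4N+2)`:
`Σ_{j,j'} v_j v_{j'} M(j,j') = Re Σ_{p,p'∈modes N} conj(c_p) c_{p'} G(p,p')`, `c_p = v(enc p 0) + i v(enc p 1)`. -/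
theorem sum_sum_range_realify_form (M : ℕ → ℕ → ℝ)
    (hM : ∀ p p' : ℤ,
      M (2 * (if 0 < p then 2 * p.natAbs - 1 else 2 * p.natAbs)) (2 * (if 0 < p' then 2 * p'.natAbs - 1 else 2 * p'.natAbs))
          = (twistedGramCoeffC χ a p p').re ∧
        M (2 * (if 0 < p then 2 * p.natAbs - 1 else 2 * p.natAbs) + 1) (2 * (if 0 < p' then 2 * p'.natAbs - 1 else 2 * p'.natAbs) + 1)
          = (twistedGramCoeffC χ a p p').re ∧
        M (2 * (if 0 < p then 2 * p.natAbs - 1 else 2 * p.natAbs)) (2 * (if 0 < p' then 2 * p'.natAbs - 1 else 2 * p'.natAbs) + 1)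
          = -(twistedGramCoeffC χ a p p').im ∧
        M (2 * (if 0 < p then 2 * p.natAbs - 1 else 2 * p.natAbs) + 1) (2 * (if 0 < p' then 2 * p'.natAbs - 1 else 2 * p'.natAbs))
          = (twistedGramCoeffC χ a p p').im)
    (N : ℕ) (v : ℕ → ℝ) :
    ∑ j ∈ Finset.range (4 * N + 2), ∑ j' ∈ Finset.range (4 * N + 2), v j * v j' * M j j'
      = (∑ p ∈ modes N, ∑ p' ∈ modes N,
          conj ((v (2 * (if 0 < p then 2 * p.natAbs - 1 else 2 * p.natAbs)) : ℂ)
              + (v (2 * (if 0 < p then 2 * p.natAbs - 1 else 2 * p.natAbs) + 1) : ℂ) * I)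
            * ((v (2 * (if 0 < p' then 2 * p'.natAbs - 1 else 2 * p'.natAbs)) : ℂ)
              + (v (2 * (if 0 < p' then 2 * p'.natAbs - 1 else 2 * p'.natAbs) + 1) : ℂ) * I)
            * twistedGramCoeffC χ a p p').re := by
  rw [sum_sum_range_realify (fun j j' ↦ v j * v j' * M j j') N, Complex.re_sum]
  refine Finset.sum_congr rfl fun p _ ↦ ?_
  rw [Complex.re_sum]
  refine Finset.sum_congr rfl fun p' _ ↦ ?_
  obtain ⟨h1, h2, h3, h4⟩ := hM p p'
  rw [h1, h2, h3, h4]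
  simp only [Complex.mul_re, Complex.mul_im, Complex.add_re, Complex.add_im, map_add, Complex.ofReal_re,
    Complex.ofReal_im, Complex.I_re, Complex.I_im, Complex.conj_ofReal, map_mul, Complex.conj_I, Complex.neg_re,
    Complex.neg_im]
  ring

/-- **Realified weights.**  `Σ_{j<4N+2} W((j/2+1)/2) v_j² = Σ_{p∈modes N} W(|p|)·‖c_p‖²`. -/
theorem sum_range_realify_weight (W : ℕ → ℝ) (N : ℕ) (v : ℕ → ℝ) :
    ∑ j ∈ Finset.range (4 * N + 2), W ((j / 2 + 1) / 2) * v j ^ 2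
      = ∑ p ∈ modes N, W p.natAbs *
          ‖((v (2 * (if 0 < p then 2 * p.natAbs - 1 else 2 * p.natAbs)) : ℂ)
              + (v (2 * (if 0 < p then 2 * p.natAbs - 1 else 2 * p.natAbs) + 1) : ℂ) * I)‖ ^ 2 := by
  rw [sum_range_realify (fun j ↦ W ((j / 2 + 1) / 2) * v j ^ 2) N]
  refine Finset.sum_congr rfl fun p _ ↦ ?_
  have e0 := modeAbs_enc p (s := 0) (by norm_num)
  have e1 := modeAbs_enc p (s := 1) (by norm_num)
  rw [add_zero] at e0
  rw [e0, e1, Complex.sq_norm, Complex.normSq_apply]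
  simp only [Complex.add_re, Complex.add_im, Complex.mul_re, Complex.mul_im, Complex.ofReal_re, Complex.ofReal_im,
    Complex.I_re, Complex.I_im]
  ring

end Realify

/-! ## The certificate theorem -/

section Cert

/-- **Format C for a COMPLEX character.**  See the module docstring.  `M` is any real symmetric table carrying the
realified entries of `twistedGramCoeffC χ a` on the interleaved enumeration (`hM`); the ℕ-block is `4B − 2` (all
`(p, re/im)` with `|p| < B`); the far weights are `W((j/2+1)/2)` with
`W(n) = 2e⁻_B(n) − A_op⁺(a) + log q` required positive for `n ≥ B`; `U` majorises the couplings (`hU`) and `hS` is the kernel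
certificate.  Conclusion: `WeilPositivityOnChar χ a`. -/
theorem weilPositivityOnChar_of_twistedC_formatC_certificates (hq : q ≠ 1) (χ : DirichletCharacter ℂ q) (ha : 0 < a)
    (M : ℕ → ℕ → ℝ) (hsymm : ∀ j j', M j j' = M j' j)
    (hM : ∀ p p' : ℤ,
      M (2 * (if 0 < p then 2 * p.natAbs - 1 else 2 * p.natAbs)) (2 * (if 0 < p' then 2 * p'.natAbs - 1 else 2 * p'.natAbs))
          = (twistedGramCoeffC χ a p p').re ∧
        M (2 * (if 0 < p then 2 * p.natAbs - 1 else 2 * p.natAbs) + 1) (2 * (if 0 < p' then 2 * p'.natAbs - 1 else 2 * p'.natAbs) + 1)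
          = (twistedGramCoeffC χ a p p').re ∧
        M (2 * (if 0 < p then 2 * p.natAbs - 1 else 2 * p.natAbs)) (2 * (if 0 < p' then 2 * p'.natAbs - 1 else 2 * p'.natAbs) + 1)
          = -(twistedGramCoeffC χ a p p').im ∧
        M (2 * (if 0 < p then 2 * p.natAbs - 1 else 2 * p.natAbs) + 1) (2 * (if 0 < p' then 2 * p'.natAbs - 1 else 2 * p'.natAbs))
          = (twistedGramCoeffC χ a p p').im)
    {B : ℕ} (hB : 2 ≤ B)
    (hW : ∀ n : ℕ, B ≤ n → 0 <
      2 * ((reDigammaQuarter (freq a n) - Real.log π) / 2 - 1 / (8 * (n : ℝ))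
          - a * (1 + weilArchDensity (2 * a)) / (π ^ 2 * (n : ℝ) ^ 2)
          - (π / 2 - Real.arctan (Real.sqrt ((B - 1 : ℕ) : ℝ) / Real.sqrt (n : ℝ))) / 2
          - a * (1 + weilArchDensity (2 * a)) / π ^ 2 * Real.sqrt (8 / ((B - 1 : ℕ) : ℝ)))
        - (∑ k ∈ weilPrimeIndex a, (Λ k : ℝ) / Real.sqrt k * (2 * Real.cos (π / (⌊2 * a / Real.log k⌋₊ + 2))))
        + Real.log q)
    (U : Matrix (Fin (4 * B - 2)) (Fin (4 * B - 2)) ℝ)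
    (hU : ∀ (N' : ℕ) (x : Fin (4 * B - 2) → ℝ),
      ∑ j ∈ Finset.Ico (4 * B - 2) N', (∑ i : Fin (4 * B - 2), M i j * x i) ^ 2 /
        (2 * ((reDigammaQuarter (freq a ((j / 2 + 1) / 2 : ℕ)) - Real.log π) / 2 - 1 / (8 * (((j / 2 + 1) / 2 : ℕ) : ℝ))
          - a * (1 + weilArchDensity (2 * a)) / (π ^ 2 * (((j / 2 + 1) / 2 : ℕ) : ℝ) ^ 2)
          - (π / 2 - Real.arctan (Real.sqrt ((B - 1 : ℕ) : ℝ) / Real.sqrt (((j / 2 + 1) / 2 : ℕ) : ℝ))) / 2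
          - a * (1 + weilArchDensity (2 * a)) / π ^ 2 * Real.sqrt (8 / ((B - 1 : ℕ) : ℝ)))
        - (∑ k ∈ weilPrimeIndex a, (Λ k : ℝ) / Real.sqrt k * (2 * Real.cos (π / (⌊2 * a / Real.log k⌋₊ + 2))))
        + Real.log q)
        ≤ x ⬝ᵥ U *ᵥ x)
    (hS : ∀ x : Fin (4 * B - 2) → ℝ, 0 ≤ ∑ i, ∑ j, x i * x j * (M i j - U i j)) :
    WeilPositivityOnChar χ a := by
  -- the far weight as a function of the mode size
  set W : ℕ → ℝ := fun n ↦ 2 * ((reDigammaQuarter (freq a n) - Real.log π) / 2 - 1 / (8 * (n : ℝ))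
          - a * (1 + weilArchDensity (2 * a)) / (π ^ 2 * (n : ℝ) ^ 2)
          - (π / 2 - Real.arctan (Real.sqrt ((B - 1 : ℕ) : ℝ) / Real.sqrt (n : ℝ))) / 2
          - a * (1 + weilArchDensity (2 * a)) / π ^ 2 * Real.sqrt (8 / ((B - 1 : ℕ) : ℝ)))
        - (∑ k ∈ weilPrimeIndex a, (Λ k : ℝ) / Real.sqrt k * (2 * Real.cos (π / (⌊2 * a / Real.log k⌋₊ + 2))))
        + Real.log q with hWdef
  -- the far block starts at mode size `B`
  have hmode : ∀ j : ℕ, 4 * B - 2 ≤ j → B ≤ (j / 2 + 1) / 2 := fun j hj ↦ by omega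
  have hd : ∀ j, 4 * B - 2 ≤ j → 0 < W ((j / 2 + 1) / 2) := fun j hj ↦ hW _ (hmode j hj)
  -- hfar from the mode-level bound
  have hfar : ∀ (N' : ℕ) (y : ℕ → ℝ),
      ∑ j ∈ Finset.Ico (4 * B - 2) N', W ((j / 2 + 1) / 2) * y j ^ 2
        ≤ ∑ j ∈ Finset.Ico (4 * B - 2) N', ∑ j' ∈ Finset.Ico (4 * B - 2) N', y j * M j j' * y j' := by
    intro N' y
    set v : ℕ → ℝ := fun j ↦ if 4 * B - 2 ≤ j ∧ j < N' then y j else 0 with hv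
    have hvz : ∀ j, ¬ (4 * B - 2 ≤ j ∧ j < N') → v j = 0 := fun j hj ↦ by simp only [hv, if_neg hj]
    have hsub : Finset.Ico (4 * B - 2) N' ⊆ Finset.range (4 * N' + 2) := fun j hj ↦ by
      rw [Finset.mem_Ico] at hj; rw [Finset.mem_range]; omega
    -- rewrite both sides over `range (4N'+2)` with `v`
    have hl : ∑ j ∈ Finset.Ico (4 * B - 2) N', W ((j / 2 + 1) / 2) * y j ^ 2
        = ∑ j ∈ Finset.range (4 * N' + 2), W ((j / 2 + 1) / 2) * v j ^ 2 := by
      rw [← Finset.sum_subset hsub (fun j _ hj ↦ by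
        rw [hvz j (by rwa [Finset.mem_Ico] at hj)]; ring)]
      refine Finset.sum_congr rfl fun j hj ↦ ?_
      rw [Finset.mem_Ico] at hj
      simp only [hv, if_pos hj]
    have hr : ∑ j ∈ Finset.Ico (4 * B - 2) N', ∑ j' ∈ Finset.Ico (4 * B - 2) N', y j * M j j' * y j'
        = ∑ j ∈ Finset.range (4 * N' + 2), ∑ j' ∈ Finset.range (4 * N' + 2), v j * v j' * M j j' := by
      rw [← Finset.sum_subset hsub (fun j _ hj ↦ by
        refine Finset.sum_eq_zero fun j' _ ↦ ?_
        rw [hvz j (by rwa [Finset.mem_Ico] at hj)]; ring)]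
      refine Finset.sum_congr rfl fun j hj ↦ ?_
      rw [← Finset.sum_subset hsub (fun j' _ hj' ↦ by
        rw [hvz j' (by rwa [Finset.mem_Ico] at hj')]; ring)]
      refine Finset.sum_congr rfl fun j' hj' ↦ ?_
      rw [Finset.mem_Ico] at hj hj'
      simp only [hv, if_pos hj, if_pos hj']
      ring
    rw [hl, hr, sum_range_realify_weight W N' v, sum_sum_range_realify_form (χ := χ) (a := a) M hM N' v]
    -- the complex vector and its support
    refine re_twistedGramCoeffC_modes_far_ge χ ha hB N' _ (fun p hp ↦ ?_) (fun p hp ↦ ?_)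
    · have h0 := hvz _ (fun h ↦ absurd h.1 (not_le.mpr (enc_lt_of_natAbs_lt (s := 0) (by norm_num) hp)))
      have h1 := hvz _ (fun h ↦ absurd h.1 (not_le.mpr (enc_lt_of_natAbs_lt (s := 1) (by norm_num) hp)))
      rw [add_zero] at h0
      rw [h0, h1]; simp
    · have h0 := hvz _ (fun h ↦ absurd h.2 (not_lt.mpr ((by omega : N' ≤ 4 * N' + 2).trans
        (le_enc_of_lt_natAbs (s := 0) hp))))
      have h1 := hvz _ (fun h ↦ absurd h.2 (not_lt.mpr ((by omega : N' ≤ 4 * N' + 2).trans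
        (le_enc_of_lt_natAbs (s := 1) hp))))
      rw [add_zero] at h0
      rw [h0, h1]; simp
  refine weilPositivityOnChar_of_twistedGramCoeffC_realify_any hq χ ha fun N x y ↦ ?_
  -- the interleaved vector of (x, y)
  set v : ℕ → ℝ := fun j ↦ if j % 2 = 0 then x (if (j / 2) % 2 = 1 then (((j / 2 + 1) / 2 : ℕ) : ℤ) else -(((j / 2) / 2 : ℕ) : ℤ))
    else y (if (j / 2) % 2 = 1 then (((j / 2 + 1) / 2 : ℕ) : ℤ) else -(((j / 2) / 2 : ℕ) : ℤ)) with hv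
  have key := sum_range_mul_mul_nonneg_of_certificate_sum M hsymm (4 * B - 2) (fun j ↦ W ((j / 2 + 1) / 2)) U hd hfar
    hU hS (4 * N + 2) v
  rw [sum_sum_range_realify_form (χ := χ) (a := a) M hM N v] at key
  -- identify `v(enc p 0) = x p`, `v(enc p 1) = y p`
  have hx : ∀ p : ℤ, v (2 * (if 0 < p then 2 * p.natAbs - 1 else 2 * p.natAbs)) = x p := fun p ↦ by
    simp only [hv]
    split_ifs <;> first | omega | (congr 1; omega)
  have hy : ∀ p : ℤ, v (2 * (if 0 < p then 2 * p.natAbs - 1 else 2 * p.natAbs) + 1) = y p := fun p ↦ by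
    simp only [hv]
    split_ifs <;> first | omega | (congr 1; omega)
  simp_rw [hx, hy] at key
  refine key.trans (le_of_eq ?_)
  rw [Complex.re_sum]
  refine Finset.sum_congr rfl fun n _ ↦ ?_
  rw [Complex.re_sum]
  refine Finset.sum_congr rfl fun m _ ↦ ?_
  simp only [Complex.mul_re, Complex.mul_im, Complex.add_re, Complex.add_im, map_add, Complex.ofReal_re,
    Complex.ofReal_im, Complex.I_re, Complex.I_im, Complex.conj_ofReal, map_mul, Complex.conj_I, Complex.neg_re,
    Complex.neg_im]
  ring

end Cert

end Summit.Ventures.WeilGRH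

end
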